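import Mathlib
import HarnessLib.Audit
import Summits.PneNP.PneNP.Theorems.PstarNorCore

/-!
# The NOR-core accounting lemma, LITERAL-EDGE form (ROUND-24, GAPTWO-PLAN S4c corrected; planner seat p3 g20)

FRONTIER range-avoidance ladder, rung F-N3, ROUND 24 (cell `pnp-ideate`; restricted-model proof complexity — nothing here bears on
`P` versus `NP`).

CORRECTION of `PstarNorCore` (same seat, same day).  Memo `CORE-BOUND-NOTES.md` §4–5 speaks of "centre edges" meaning the outputs of the
core that carry one of the two pinned LITERALS `σ, τ` in an AND slot, and of "chords" meaning the remaining outputs, which are clean and close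
alternating `σ/τ`-paths.  `PstarNorCore.NorStructure` typed "centre" as `¬ IsChord` (AND-shared inside `J₀`), which is a different notion:
in the calibration cores (kit K11 `(5,2)` = K12 `CONS-T`, the triangle `(σ,b₁)(τ,b₂)+chord`; K11 `(7,3)` = K12 `CONS-P3`, two triangles on a
common edge) a literal edge whose literal occurs once in `J₀` IS an `IsChord`, and clause 5 of `NorStructure` then fails for it.  So
`NorCoreBound` is (believed) true but does not speak about the cores that occur.  The intended statement is the one below, with

* `LitEdge I σ τ f`      : output `f` has `σ` or `τ` in an AND slot;
* `LitAdj I J₀ σ τ`      : adjacency of XOR variables through literal edges of `J₀`;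
* `LitNorStructure`      : `σ ≠ τ`, a reader `g₀ ∉ J₀` with AND pair `{σ, τ}`, and every NON-literal output of `J₀` is a chord (`IsChord`,
                           both AND variables private inside `J₀`) whose XOR pair is joined by a path of literal edges of `J₀`;
* `LitNorCoreBound`      : such an XOR-closed `J₀` with `#J₀ < r` on an `(r,3/2)`-boundary-expanding pure `P⋆` instance with simple overlaps has
                           at most `5` outputs (attained by `CONS-P3`; `CONS-T` has `3`).

The proof is memo §5 verbatim: by simple overlaps the `σ`-edges are pairwise XOR-disjoint and so are the `τ`-edges, so the literal subgraph has
maximum degree `2` (alternating paths; alternating cycles are expansion-dead); `P_L` alone forces `L ≤ 4`; the chord exclusions (no chord at an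
endpoint edge of `P_4`: `7 < 7.5`; no long chord of `P_3` next to `g₀`: `7 < 7.5`; no two chords with the same ends: SO) give at most `L - 1`
chords per component; and the family `{g₀} ∪ J₀` has at most `#lit + 2·#chords + 2` boundary variables against `3/2·(#J₀ + 1)` required, whence
`#chords ≥ #lit - 1`, one component, `#J₀ ∈ {0, 3, 5}`.

This file only TYPES the corrected target (S4c of GAPTWO-PLAN v1); `norBound_le` style sanity lemmas are left to the prover who takes it.
-/

set_option linter.dupNamespace false

open Finset Literature.Computability.Complexity
open Summit.PneNP.PneNP.Theorems.PstarSALevel (varSet bdry BoundaryExpanding SimpleOverlap)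
open Summit.PneNP.PneNP.Theorems.PstarChordRepair (IsChord)
open Summit.PneNP.PneNP.Theorems.PstarCoreBound (XorClosed)

namespace Summit.PneNP.PneNP.Theorems.PstarLitNorCore

variable {n m : ℕ}

/-- `f` is a LITERAL EDGE for the pair `(σ, τ)`: one of its AND slots holds `σ` or `τ`. -/
def LitEdge (I : LocalMap 4 n m) (σ τ : Fin n) (f : Fin m) : Prop :=
  I.vars f 2 = σ ∨ I.vars f 2 = τ ∨ I.vars f 3 = σ ∨ I.vars f 3 = τ

/-- Two XOR variables are LITERAL-ADJACENT in `J₀` if some literal edge of `J₀` has exactly them as its XOR pair. -/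
def LitAdj (I : LocalMap 4 n m) (J₀ : Finset (Fin m)) (σ τ : Fin n) (v v' : Fin n) : Prop :=
  ∃ f ∈ J₀, LitEdge I σ τ f ∧ ((I.vars f 0 = v ∧ I.vars f 1 = v') ∨ (I.vars f 0 = v' ∧ I.vars f 1 = v))

/-- **NOR structure, literal-edge form** of a set `J₀` of outputs on the literal pair `(σ, τ)` with reader `g₀`: `σ ≠ τ`; `g₀ ∉ J₀` has AND
pair `{σ, τ}`; every output of `J₀` that is not a literal edge is a chord of `J₀` (both AND variables private inside `J₀`) whose XOR pair is
joined by a path of literal edges of `J₀`. -/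
def LitNorStructure (I : LocalMap 4 n m) (J₀ : Finset (Fin m)) (σ τ : Fin n) (g₀ : Fin m) : Prop :=
  σ ≠ τ ∧ g₀ ∉ J₀ ∧ ((I.vars g₀ 2 = σ ∧ I.vars g₀ 3 = τ) ∨ (I.vars g₀ 2 = τ ∧ I.vars g₀ 3 = σ)) ∧
  ∀ e ∈ J₀, ¬ LitEdge I σ τ e → IsChord I J₀ e ∧ Relation.ReflTransGen (LitAdj I J₀ σ τ) (I.vars e 0) (I.vars e 1)

/-- **GAPTWO-PLAN S4c (corrected) — the NOR-core accounting lemma, literal-edge form (OPEN; proof = memo §5).**  FRONTIER. -/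
@[conjecture] def LitNorCoreBound : Prop :=
  ∀ (n m r : ℕ) (I : LocalMap 4 n m), I.IsPure xorAndPred → BoundaryExpanding r I → SimpleOverlap I →
    ∀ (J₀ : Finset (Fin m)) (σ τ : Fin n) (g₀ : Fin m), J₀.card < r → XorClosed I J₀ → LitNorStructure I J₀ σ τ g₀ → J₀.card ≤ 5

/-- Sanity: the empty family carries the structure as soon as a reader `g₀ = (σ,τ;·,·)` with `σ ≠ τ` exists. -/
theorem litNorStructure_empty (I : LocalMap 4 n m) {σ τ : Fin n} {g₀ : Fin m} (hne : σ ≠ τ)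
    (hg : (I.vars g₀ 2 = σ ∧ I.vars g₀ 3 = τ) ∨ (I.vars g₀ 2 = τ ∧ I.vars g₀ 3 = σ)) : LitNorStructure I ∅ σ τ g₀ := by
  refine ⟨hne, by simp, hg, ?_⟩
  intro e he; simp at he

/-- Sanity: if EVERY output of `J₀` is a literal edge, the chord clause is vacuous. -/
theorem litNorStructure_of_forall_litEdge (I : LocalMap 4 n m) {J₀ : Finset (Fin m)} {σ τ : Fin n} {g₀ : Fin m} (hne : σ ≠ τ)
    (hg₀ : g₀ ∉ J₀) (hg : (I.vars g₀ 2 = σ ∧ I.vars g₀ 3 = τ) ∨ (I.vars g₀ 2 = τ ∧ I.vars g₀ 3 = σ))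
    (hall : ∀ e ∈ J₀, LitEdge I σ τ e) : LitNorStructure I J₀ σ τ g₀ :=
  ⟨hne, hg₀, hg, fun e he hne' => absurd (hall e he) hne'⟩

end Summit.PneNP.PneNP.Theorems.PstarLitNorCore
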